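import Literature.NumberTheory.EllipticCurves.IwasawaNoFiniteSubmoduleProofs
import Literature.NumberTheory.EllipticCurves.IwasawaNakayamaProofs
import HarnessLib

/-!
# The Hachimori–Matsuno criterion: self-dual finite layers with stabilised divisible parts force
# `X[T]` to be `p`-torsion-free, hence NO non-zero finite `Λ`-submodule in the Pontryagin dual
# (pure algebra; cell `bsd-potss`, seat `bsd-potss-k8q-c5` g3; K8-Gss2 node (R2±)
# `NoFiniteSubmoduleSigned`, items stmt-BirchSwinnertonDyer-19117 / 19222 / 19233, binder 19301)

HONEST FRAMING (cell `bsd-potss`, run/shared/lean/pub/bsd-potss/; FULL-BSD rank ≤ 1 programme,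
tranche 1b): THEOREMS ONLY — elementary additive group theory plus the tree's Lemma 3.30 (2) of
Kitajima–Otsuki / NSW 5.3.19 (`IwasawaAlgebra.forall_finite_eq_bot_of_forall_pow_smul_invariants_eq_zero`).
NO elliptic-curve input, NO named fact, NO definition; nothing is asserted about any Selmer group;
nothing booked; no label / mark / count moves; BSD is not proved by any of this.

PURPOSE. The K8 binder `PublishedInputKO13` is Kitajima–Otsuki 2018 Main Thm. 1.3 (`F = ℚ`), whose §4.1
(Thm. 4.5) rests on Matsuno 2003 Prop. 4.1 = the Cassels–Tate mechanism of Hachimori–Matsuno (Proc.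
AMS 128 (2000) 2539–2541): the maximal divisible subgroups `D_n ⊆ Sel(E/K_n)` stabilise when `X` is
`Λ`-torsion, `C_n = Sel(E/K_n)/D_n` carries a non-degenerate Galois-equivariant pairing under which
restriction and corestriction are adjoint, and Washington's norm argument (Introduction to Cyclotomic
Fields, Prop. 13.28) kills every finite `Λ`-submodule. THIS FILE is that mechanism as ONE abstract
theorem on a discrete module `S` (= `Sel_∞`) exhausted by layers `L_n` (= `Sel(E/K_n)`, any Selmer
condition) — `eq_zero_of_forall_apply_comp_eq_of_pow_nsmul_eq_zero`: **every `Γ`-invariant character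
of `S` of `p`-power order is zero** — and its dual reading
`forall_finite_eq_bot_of_selfDualLayers` / `forall_finite_eq_bot_of_selfDualLayers_of_isDualPair`:
**`X[T]` is `p`-torsion-free, so `X` has no non-zero finite `Λ`-submodule.** Two simplifications of
the printed proof, both elementary: (a) by Lemma 3.30 (2) only the `T`-invariants `X[T] = (S_Γ)^∨`
matter, so the character `f` may be taken `Γ`-INVARIANT (not merely `Γ_n`-invariant), and (b)
induction on the exponent `k` (`p^{k+1} f = 0 ⟹ p·f` is again `Γ`-invariant of exponent `k`) reduces
Washington's inverse-limit argument to ONE norm step `n + 1 → n`; no inverse limit, no iterated norm,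
no snake lemma is needed, and of the stabilisation only `r_{n+1}(D_{n+1}) ⊆ r_n(D_n)` (`n ≥ m`) is used.

## The hypotheses (all displayed; `γ` an additive endomorphism of `S`, "`= conj_γ`")

layers `r_n : L_n → S` injective (Kobayashi Lemma 9.1 / Greenberg Lemma 3.1-type), transition
`ι_n : L_n → L_{n+1}` over `S`, exhausting `S`; a surjective `Γ`-action `γL_n` on `L_n` over `γ`;
"corestrictions": every `t ∈ L_{n+1}` has some `t' ∈ L_n` (`= cores t`) with
**`r_n t' = Σ_{i<p} γ^{pⁿ i} r_{n+1} t`** (res ∘ cores = norm of `Gal(K_{n+1}/K_n) = ⟨γ^{pⁿ}⟩`), ADJOINT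
to the transition: `⟨y, t'⟩_n = ⟨ι_n y, t⟩_{n+1}`; subgroups `D_n ≤ L_n`, `p`-divisible, `γL_n`-stable,
with `r_{n+1}(D_{n+1}) ⊆ r_n(D_n)` for `n ≥ m`; biadditive pairings `⟨·,·⟩_n` on `L_n` with right
kernel EXACTLY `D_n`, every character of `L_n/D_n` represented (`y ↦ ⟨y, c⟩_n`), `γL_n`-invariant.
For `L_n = Sel_{p^∞}(E/K_n)`, `D_n` its maximal divisible
subgroup, these are: cofinite generation + the Cassels–Tate pairing on `Ш(E/K_n)[p^∞]/div` (Milne, ADT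
I §6) — Hachimori–Matsuno's input verbatim; for Kobayashi's `Sel^±` the pairing is B. D. Kim's /
Flach's generalised Cassels–Tate pairing (self-duality of the `±` local condition).

References: [HachimoriMatsuno2000] Y. Hachimori, K. Matsuno, Proc. Amer. Math. Soc. 128 (2000)
2539–2541, Theorem and its proof; [Washington1997] L. C. Washington, Introduction to Cyclotomic Fields,
Prop. 13.28; [KitajimaOtsuki2018] T. Kitajima, R. Otsuki, Tokyo J. Math. 41 (2018), Lemma 3.30 (2),
Prop. 4.1, Thm. 4.5 (arXiv:1607.03612 pp. 17–18); [GreenbergLNM1716] R. Greenberg, LNM 1716 (1999), §1.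
-/

set_option autoImplicit false

noncomputable section

open scoped Classical

open Literature.NumberTheory.EllipticCurves Literature.NumberTheory.EllipticCurves.IwasawaAlgebra
  Literature.NumberTheory.EllipticCurves.IwasawaDual

namespace Summit.BirchSwinnertonDyer.Rank1Residual.Iwasawa

variable (p : ℕ)

/-! ## §1 Elementary lemmas on the discrete side -/

section Discrete

variable {S : Type*} [AddCommGroup S]

/-- If `γ z − z` lies in a `γ`-stable subgroup `D`, so does `γ^i z − z` for every `i`
(telescoping). [folklore] -/
theorem pow_apply_sub_mem_of_apply_sub_mem (γ : AddMonoid.End S) (D : AddSubgroup S)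
    (hD : ∀ d ∈ D, γ d ∈ D) {z : S} (hz : γ z - z ∈ D) (i : ℕ) : (γ ^ i) z - z ∈ D := by
  induction i with
  | zero => rw [pow_zero, AddMonoid.End.one_apply, sub_self]; exact D.zero_mem
  | succ i ih =>
    have h1 : (γ ^ (i + 1)) z - z = γ ((γ ^ i) z - z) + (γ z - z) := by
      rw [pow_succ', AddMonoid.End.coe_mul, Function.comp_apply, map_sub]; abel
    rw [h1]
    exact D.add_mem (hD _ ih) hz

/-- The norm `Σ_{i<p} γ^{e i}` acts as multiplication by `p` modulo a `γ`-stable subgroup `D` on every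
`z` with `γ z − z ∈ D`. [cite: Washington1997, Prop. 13.28 (proof)] -/
theorem sum_pow_apply_sub_nsmul_mem (γ : AddMonoid.End S) (D : AddSubgroup S)
    (hD : ∀ d ∈ D, γ d ∈ D) {z : S} (hz : γ z - z ∈ D) (e : ℕ) :
    (∑ i ∈ Finset.range p, (γ ^ (e * i)) z) - p • z ∈ D := by
  have h : (∑ i ∈ Finset.range p, (γ ^ (e * i)) z) - p • z =
      ∑ i ∈ Finset.range p, ((γ ^ (e * i)) z - z) := by
    rw [Finset.sum_sub_distrib, Finset.sum_const, Finset.card_range]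
  rw [h]
  exact D.sum_mem fun i _ ↦ by
    rw [pow_mul]
    exact pow_apply_sub_mem_of_apply_sub_mem (γ ^ e) D
      (fun d hd ↦ by
        have := pow_apply_sub_mem_of_apply_sub_mem γ D hD (z := d)
          (by simpa using D.sub_mem (hD d hd) hd) e
        simpa using D.add_mem this hd)
      (pow_apply_sub_mem_of_apply_sub_mem γ D hD hz e) i

end Discrete

/-! ## §2 The Hachimori–Matsuno–Washington mechanism on the discrete side -/

section Layers

variable {S : Type*} [AddCommGroup S] (γ : AddMonoid.End S)
  {L : ℕ → Type*} [∀ n, AddCommGroup (L n)]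
  (r : ∀ n, L n →+ S) (ι : ∀ n, L n →+ L (n + 1)) (γL : ∀ n, L n →+ L n)
  (D : ∀ n, AddSubgroup (L n)) (pair : ∀ n, L n →+ L n →+ AddCircle (1 : ℚ))

/-- A class coming from layer `n₀` comes from every higher layer `n ≥ n₀` (iterate the transition
maps `ι`). [folklore] -/
theorem exists_eq_of_le_layer (hι : ∀ n (x : L n), r (n + 1) (ι n x) = r n x)
    {s : S} {n₀ : ℕ} (hs : ∃ x : L n₀, r n₀ x = s) {n : ℕ} (hn : n₀ ≤ n) : ∃ x : L n, r n x = s := by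
  induction n, hn using Nat.le_induction with
  | base => exact hs
  | succ n _ ih =>
    obtain ⟨x, hx⟩ := ih
    exact ⟨ι n x, by rw [hι, hx]⟩

/-- **One norm step (the case `p·f = 0`).** Under the displayed layer hypotheses (module docstring),
a `γ`-invariant character `f` of `S` with `p • f = 0` vanishes. Proof (Hachimori–Matsuno /
Washington 13.28, one step): represent `f ∘ r_j = ⟨·, c_j⟩_j` (`f` kills the divisible `D_j`); then
`p c_{n+1} ∈ D_{n+1}`, `γL c_{n+1} ≡ c_{n+1}`, and by adjointness `c_n ≡ N_n c_{n+1} (mod D_n)`, whose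
image in `S` is the norm `Σ_{i<p} γ^{pⁿ i} r_{n+1}(c_{n+1}) ≡ p·r_{n+1}(c_{n+1}) ≡ 0` modulo
`r_{n+1}(D_{n+1}) ⊆ r_n(D_n)` (`n ≥ m`); so `c_n ∈ D_n` and `f = ⟨·, c_n⟩_n ∘ r_n⁻¹ = 0` on `r_n(L_n)`.
[cite: HachimoriMatsuno2000, Theorem (proof, pp. 2540–2541)] [cite: Washington1997, Prop. 13.28] -/
theorem eq_zero_of_forall_apply_comp_eq_of_nsmul_eq_zero
    (hr : ∀ n, Function.Injective (r n))
    (hι : ∀ n (x : L n), r (n + 1) (ι n x) = r n x)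
    (hex : ∀ s : S, ∃ n, ∃ x : L n, r n x = s)
    (hγL : ∀ n (x : L n), r n (γL n x) = γ (r n x)) (hγLs : ∀ n, Function.Surjective (γL n))
    (hcores : ∀ n (t : L (n + 1)), ∃ t' : L n,
      r n t' = ∑ i ∈ Finset.range p, (γ ^ (p ^ n * i)) (r (n + 1) t) ∧
        ∀ y : L n, pair n y t' = pair (n + 1) (ι n y) t)
    (hDdiv : ∀ n, ∀ d ∈ D n, ∃ d' ∈ D n, p • d' = d)
    (hDγ : ∀ n, ∀ d ∈ D n, γL n d ∈ D n)
    (m : ℕ) (hDst : ∀ n, m ≤ n → (D (n + 1)).map (r (n + 1)) ≤ (D n).map (r n))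
    (hker : ∀ n (t : L n), (∀ y : L n, pair n y t = 0) → t ∈ D n)
    (hD0 : ∀ n, ∀ t ∈ D n, ∀ y : L n, pair n y t = 0)
    (hsurj : ∀ n (g : L n →+ AddCircle (1 : ℚ)), (∀ d ∈ D n, g d = 0) →
      ∃ c : L n, ∀ y : L n, g y = pair n y c)
    (hinv : ∀ n (y t : L n), pair n (γL n y) (γL n t) = pair n y t)
    (f : S →+ AddCircle (1 : ℚ)) (hf : ∀ s, f (γ s) = f s) (hpf : p • f = 0) : f = 0 := by
  -- `f ∘ r_j` kills `D_j`, hence is represented by some `c_j`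
  have hrep : ∀ j, ∃ c : L j, ∀ y : L j, f (r j y) = pair j y c := fun j ↦ by
    refine hsurj j (f.comp (r j)) fun d hd ↦ ?_
    obtain ⟨d', -, rfl⟩ := hDdiv j d hd
    rw [AddMonoidHom.comp_apply, map_nsmul, map_nsmul, ← AddMonoidHom.nsmul_apply, hpf,
      AddMonoidHom.zero_apply]
  choose c hc using hrep
  -- (i) `p • c_j ∈ D_j`
  have hpc : ∀ j, p • c j ∈ D j := fun j ↦ hker j _ fun y ↦ by
    rw [map_nsmul, ← hc, ← AddMonoidHom.nsmul_apply, hpf, AddMonoidHom.zero_apply]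
  -- (ii) `γ (r_j c_j) − r_j c_j ∈ r_j(D_j)`, a `γ`-stable subgroup of `S`
  have hDmapγ : ∀ j, ∀ d ∈ (D j).map (r j), γ d ∈ (D j).map (r j) := fun j d hd ↦ by
    obtain ⟨d₀, hd₀, rfl⟩ := hd
    exact ⟨γL j d₀, hDγ j d₀ hd₀, hγL j d₀⟩
  have hγc : ∀ j, γ (r j (c j)) - r j (c j) ∈ (D j).map (r j) := fun j ↦ by
    have hmem : γL j (c j) - c j ∈ D j := hker j _ fun y ↦ by
      obtain ⟨y', rfl⟩ := hγLs j y
      rw [map_sub, sub_eq_zero, hinv, ← hc, ← hc, hγL, hf]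
    exact ⟨_, hmem, by rw [map_sub, hγL]⟩
  -- (iii) adjointness: `r_n c_n − Σ_{i<p} γ^{pⁿ i} r_{n+1} c_{n+1} ∈ r_n(D_n)`
  have hNc : ∀ n, r n (c n) - ∑ i ∈ Finset.range p, (γ ^ (p ^ n * i)) (r (n + 1) (c (n + 1))) ∈
      (D n).map (r n) := fun n ↦ by
    obtain ⟨t', ht'r, ht'adj⟩ := hcores n (c (n + 1))
    have hmem : c n - t' ∈ D n := hker n _ fun y ↦ by
      rw [map_sub, sub_eq_zero, ← hc, ht'adj, ← hc, hι]
    exact ⟨_, hmem, by rw [map_sub, ht'r]⟩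
  -- (iv) for `n ≥ m`: `c_n ∈ D_n`
  have hcD : ∀ n, m ≤ n → c n ∈ D n := fun n hn ↦ by
    have h1 : (∑ i ∈ Finset.range p, (γ ^ (p ^ n * i)) (r (n + 1) (c (n + 1)))) -
        p • r (n + 1) (c (n + 1)) ∈ (D (n + 1)).map (r (n + 1)) :=
      sum_pow_apply_sub_nsmul_mem p γ _ (hDmapγ (n + 1)) (hγc (n + 1)) (p ^ n)
    have h2 : p • r (n + 1) (c (n + 1)) ∈ (D (n + 1)).map (r (n + 1)) :=
      ⟨p • c (n + 1), hpc (n + 1), map_nsmul _ _ _⟩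
    have h3 : ∑ i ∈ Finset.range p, (γ ^ (p ^ n * i)) (r (n + 1) (c (n + 1))) ∈ (D n).map (r n) :=
      hDst n hn (by simpa using (AddSubgroup.map (r (n + 1)) (D (n + 1))).add_mem h1 h2)
    have h4 : r n (c n) ∈ (D n).map (r n) := by
      simpa using ((D n).map (r n)).add_mem (hNc n) h3
    obtain ⟨d, hd, hdc⟩ := h4
    rwa [← hr n hdc]
  -- (v) conclude on `S = ⋃ r_n(L_n)`
  ext s
  obtain ⟨n₀, hx₀⟩ := hex s
  obtain ⟨x, rfl⟩ := exists_eq_of_le_layer r ι hι hx₀ (Nat.le_add_left n₀ m)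
  rw [AddMonoidHom.zero_apply, hc, hD0 _ _ (hcD _ (Nat.le_add_right m n₀))]

/-- **The Hachimori–Matsuno criterion on the discrete side.** Under the displayed layer hypotheses
(module docstring), every `γ`-invariant character `f` of `S` of `p`-power order is zero — i.e. the
`Γ`-coinvariants `S_Γ` have a `p`-torsion-free (hence, when cofinitely generated, free) Pontryagin dual
`X[T]`. Induction on the exponent: `p·f` is again `γ`-invariant of smaller exponent, and the case
`p·f = 0` is `eq_zero_of_forall_apply_comp_eq_of_nsmul_eq_zero`.
[cite: HachimoriMatsuno2000, Theorem (proof, pp. 2540–2541)] [cite: Washington1997, Prop. 13.28] -/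
theorem eq_zero_of_forall_apply_comp_eq_of_pow_nsmul_eq_zero
    (hr : ∀ n, Function.Injective (r n))
    (hι : ∀ n (x : L n), r (n + 1) (ι n x) = r n x)
    (hex : ∀ s : S, ∃ n, ∃ x : L n, r n x = s)
    (hγL : ∀ n (x : L n), r n (γL n x) = γ (r n x)) (hγLs : ∀ n, Function.Surjective (γL n))
    (hcores : ∀ n (t : L (n + 1)), ∃ t' : L n,
      r n t' = ∑ i ∈ Finset.range p, (γ ^ (p ^ n * i)) (r (n + 1) t) ∧
        ∀ y : L n, pair n y t' = pair (n + 1) (ι n y) t)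
    (hDdiv : ∀ n, ∀ d ∈ D n, ∃ d' ∈ D n, p • d' = d)
    (hDγ : ∀ n, ∀ d ∈ D n, γL n d ∈ D n)
    (m : ℕ) (hDst : ∀ n, m ≤ n → (D (n + 1)).map (r (n + 1)) ≤ (D n).map (r n))
    (hker : ∀ n (t : L n), (∀ y : L n, pair n y t = 0) → t ∈ D n)
    (hD0 : ∀ n, ∀ t ∈ D n, ∀ y : L n, pair n y t = 0)
    (hsurj : ∀ n (g : L n →+ AddCircle (1 : ℚ)), (∀ d ∈ D n, g d = 0) →
      ∃ c : L n, ∀ y : L n, g y = pair n y c)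
    (hinv : ∀ n (y t : L n), pair n (γL n y) (γL n t) = pair n y t)
    (f : S →+ AddCircle (1 : ℚ)) (hf : ∀ s, f (γ s) = f s) (k : ℕ) (hpf : p ^ k • f = 0) :
    f = 0 := by
  induction k generalizing f with
  | zero => simpa using hpf
  | succ k ih =>
    have hp1 : p • f = 0 := by
      refine ih (p • f) (fun s ↦ ?_) ?_
      · rw [AddMonoidHom.nsmul_apply, AddMonoidHom.nsmul_apply, hf]
      · rw [← mul_nsmul', ← pow_succ, hpf]
    exact eq_zero_of_forall_apply_comp_eq_of_nsmul_eq_zero p γ r ι γL D pair hr hι hex hγL hγLs hcores hDdiv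
      hDγ m hDst hker hD0 hsurj hinv f hf hp1

end Layers

/-! ## §3 The dual reading: `X[T]` is `p`-torsion-free, `X` has no non-zero finite `Λ`-submodule -/

section Dual

variable [Fact p.Prime] {S : Type*} [AddCommGroup S] (γ : AddMonoid.End S)
  {L : ℕ → Type*} [∀ n, AddCommGroup (L n)]
  (r : ∀ n, L n →+ S) (ι : ∀ n, L n →+ L (n + 1)) (γL : ∀ n, L n →+ L n)
  (D : ∀ n, AddSubgroup (L n)) (pair : ∀ n, L n →+ L n →+ AddCircle (1 : ℚ))
  {X : Type*} [AddCommGroup X] [Module (IwasawaAlgebra p) X]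
  (toDual : X →+ (S →+ AddCircle (1 : ℚ)))

/-- **The Hachimori–Matsuno criterion, dual side.** Let `X` be a `Λ = ℤ_p⟦T⟧`-module with an injective
additive `toDual : X → Hom(S, ℚ/ℤ)` along which `T` acts as `γ − 1` (`toDual (T•x) s = toDual x (γ s) −
toDual x s` — the fields of every Pontryagin-dual datum of the tree, `SelmerDualData`,
`SignedSelmerDualData`, `StrictSignedSelmerDualData`, `Tower…DualData`). Under the displayed layer
hypotheses on `S` (module docstring: injective exhausting `Γ`-stable layers, res ∘ cores = norm,
`p`-divisible `Γ`-stable `D_n` with `r_{n+1}(D_{n+1}) ⊆ r_n(D_n)` for `n ≥ m`, pairings with right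
kernel `D_n` representing every character of `L_n/D_n`, `Γ`-invariant and res/cores-adjoint), **every
finite `Λ`-submodule of `X` is `0`**: a non-zero finite submodule would meet `X[T]` in a non-zero
`p`-power-torsion element (Lemma 3.30 (2), tree
`forall_finite_eq_bot_of_forall_pow_smul_invariants_eq_zero`), whose character is `γ`-invariant of
`p`-power order, hence zero by §2. This is the Theorem of Hachimori–Matsuno 2000 in the case
`𝔛 = lim X_n = 0` (injective layers), for ANY Selmer-type condition carrying such pairings.
[cite: HachimoriMatsuno2000, Theorem and Corollary (i) (p. 2540)]
[cite: KitajimaOtsuki2018, Lemma 3.30 (2), Prop. 4.1, Thm. 4.5 (arXiv:1607.03612 pp. 17–18)] -/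
theorem forall_finite_eq_bot_of_selfDualLayers
    (hr : ∀ n, Function.Injective (r n))
    (hι : ∀ n (x : L n), r (n + 1) (ι n x) = r n x)
    (hex : ∀ s : S, ∃ n, ∃ x : L n, r n x = s)
    (hγL : ∀ n (x : L n), r n (γL n x) = γ (r n x)) (hγLs : ∀ n, Function.Surjective (γL n))
    (hcores : ∀ n (t : L (n + 1)), ∃ t' : L n,
      r n t' = ∑ i ∈ Finset.range p, (γ ^ (p ^ n * i)) (r (n + 1) t) ∧
        ∀ y : L n, pair n y t' = pair (n + 1) (ι n y) t)
    (hDdiv : ∀ n, ∀ d ∈ D n, ∃ d' ∈ D n, p • d' = d)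
    (hDγ : ∀ n, ∀ d ∈ D n, γL n d ∈ D n)
    (m : ℕ) (hDst : ∀ n, m ≤ n → (D (n + 1)).map (r (n + 1)) ≤ (D n).map (r n))
    (hker : ∀ n (t : L n), (∀ y : L n, pair n y t = 0) → t ∈ D n)
    (hD0 : ∀ n, ∀ t ∈ D n, ∀ y : L n, pair n y t = 0)
    (hsurj : ∀ n (g : L n →+ AddCircle (1 : ℚ)), (∀ d ∈ D n, g d = 0) →
      ∃ c : L n, ∀ y : L n, g y = pair n y c)
    (hinv : ∀ n (y t : L n), pair n (γL n y) (γL n t) = pair n y t)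
    (hinj : Function.Injective toDual)
    (hT : ∀ (x : X) (s : S),
      toDual ((PowerSeries.X : IwasawaAlgebra p) • x) s = toDual x (γ s) - toDual x s) :
    ∀ M : Submodule (IwasawaAlgebra p) X, Finite M → M = ⊥ := by
  refine forall_finite_eq_bot_of_forall_pow_smul_invariants_eq_zero p fun x hx k hk ↦ ?_
  have hf : ∀ s, toDual x (γ s) = toDual x s := fun s ↦ by
    rw [← sub_eq_zero, ← hT, (mem_invariants_iff p X x).mp hx, map_zero, AddMonoidHom.zero_apply]
  have hpf : p ^ k • toDual x = 0 := by rw [← map_nsmul, hk, map_zero]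
  apply hinj
  rw [map_zero]
  exact eq_zero_of_forall_apply_comp_eq_of_pow_nsmul_eq_zero p γ r ι γL D pair hr hι hex hγL hγLs hcores hDdiv
    hDγ m hDst hker hD0 hsurj hinv (toDual x) hf k hpf

/-- **The same for an axiomatic dual pair** `IsDualPair p ψ toDual` (the tree's interface: `toDual`
bijective, `T ↦ ψ`, constants through `ℤ_p → ℤ/p^k`, local nilpotence), with `γ = ψ + 1`: under the
displayed layer hypotheses `X` has no non-zero finite `Λ`-submodule.
[cite: HachimoriMatsuno2000, Theorem and Corollary (i) (p. 2540)] [cite: GreenbergLNM1716, §1 (p. 60)] -/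
theorem forall_finite_eq_bot_of_selfDualLayers_of_isDualPair {ψ : AddMonoid.End S}
    (h : IsDualPair p ψ toDual)
    (hr : ∀ n, Function.Injective (r n))
    (hι : ∀ n (x : L n), r (n + 1) (ι n x) = r n x)
    (hex : ∀ s : S, ∃ n, ∃ x : L n, r n x = s)
    (hγL : ∀ n (x : L n), r n (γL n x) = (ψ + 1) (r n x)) (hγLs : ∀ n, Function.Surjective (γL n))
    (hcores : ∀ n (t : L (n + 1)), ∃ t' : L n,
      r n t' = ∑ i ∈ Finset.range p, ((ψ + 1) ^ (p ^ n * i)) (r (n + 1) t) ∧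
        ∀ y : L n, pair n y t' = pair (n + 1) (ι n y) t)
    (hDdiv : ∀ n, ∀ d ∈ D n, ∃ d' ∈ D n, p • d' = d)
    (hDγ : ∀ n, ∀ d ∈ D n, γL n d ∈ D n)
    (m : ℕ) (hDst : ∀ n, m ≤ n → (D (n + 1)).map (r (n + 1)) ≤ (D n).map (r n))
    (hker : ∀ n (t : L n), (∀ y : L n, pair n y t = 0) → t ∈ D n)
    (hD0 : ∀ n, ∀ t ∈ D n, ∀ y : L n, pair n y t = 0)
    (hsurj : ∀ n (g : L n →+ AddCircle (1 : ℚ)), (∀ d ∈ D n, g d = 0) →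
      ∃ c : L n, ∀ y : L n, g y = pair n y c)
    (hinv : ∀ n (y t : L n), pair n (γL n y) (γL n t) = pair n y t) :
    ∀ M : Submodule (IwasawaAlgebra p) X, Finite M → M = ⊥ :=
  forall_finite_eq_bot_of_selfDualLayers p (ψ + 1) r ι γL D pair toDual hr hι hex hγL hγLs hcores hDdiv
    hDγ m hDst hker hD0 hsurj hinv h.bijective.1 fun x s ↦ by
      rw [h.T_smul]
      show toDual x (ψ s) = toDual x (ψ s + s) - toDual x s
      rw [map_add, add_sub_cancel_right]

end Dual

end Summit.BirchSwinnertonDyer.Rank1Residual.Iwasawa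

end
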